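import Literature.Probability.RandomPlanarGeometry.SAWBridgeDivergence
import Mathlib.Analysis.SpecialFunctions.Pow.Real
import HarnessLib

/-!
# Span-resolved bridge generating functions: supermultiplicativity in the span, Hutchcroft's
# Lemma 2.3 `a(z_c;A) ≤ 1`, and the route from a span rate to a Hammersley–Welsh bound

Topic `Literature/Probability/RandomPlanarGeometry` (continues `SAWBridgeDivergence.lean`: `brSpan d m A`
= the `m`-step bridges of span `A`, i.e. endpoint level `ω m 0 = A` — bridges in the FIRST coordinate,
Madras–Slade Def. 1.2.4; the truncated generating functions `brGF d M z A = Σ_{m ≤ M} #brSpan(m,A) z^m`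
and `bridgeGFpos d M z = Σ_{1 ≤ m ≤ M} b_m z^m`; the finite Madras–Slade (3.1.13) `sum_count_le_exp`).
Source: T. Hutchcroft, *The Hammersley–Welsh bound for self-avoiding walk revisited*, Electron.
Commun. Probab. 23 (2018), paper no. 5 (arXiv:1708.09460), §2.1: "`a(z;n) = Σ_ω z^{|ω|} 1[ω : 0 → L_n`
is a SAB] … the sequence `a(z;n)` is supermultiplicative … `a(z;n+m) ≥ a(z;n)a(z;m)` … It follows by
Fekete's lemma that … `a(z;n) ≤ e^{-ξ(z)n}` (2.2). **Lemma 2.3.** `ξ(z_c) ≥ 0`" (proof: "If `z < z_c`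
then `B(z) = Σ_n a(z;n) < ∞`, so that … `a(z;n) ≤ 1` … it also holds for `z = z_c` by left continuity").
Hutchcroft's SAB use the `d`-th coordinate, the tree's bridges the first: the same objects up to a
permutation of coordinates. DESIGN: everything is stated for the length-TRUNCATED sums `brGF d M z A`,
uniformly in `M` — no infinite series and no summability side conditions appear; "`a(z;A) ≤ t`"
below always means "every truncation `V_M(z;A) := brGF d M z A` is `≤ t`".

## Contents (namespace `Literature.Probability.RandomPlanarGeometry.SAW.Zd`; all PROVED, no facts)

* `concatWalk_mem_brSpan`, `sum_card_brSpan_mul_le` — concatenating a span-`A₁` and a span-`A₂`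
  bridge gives a span-`(A₁+A₂)` bridge, injectively in (cut time, pieces):
  `Σ_{m₁+m₂=m} β_{m₁,A₁} β_{m₂,A₂} ≤ β_{m,A₁+A₂}`;
* `brGF_mul_le`, `brGF_pow_le` — `V_{M₁}(z;A₁) V_{M₂}(z;A₂) ≤ V_{M₁+M₂}(z;A₁+A₂)`, `V_M^k ≤ V_{kM}(kA)`;
* `brGF_le_geom`, `brGF_le_one_of_lt`, **`brGF_critical_le_one`** — `V_M(z;A) ≤ (1-zμ)⁻¹` and `≤ 1`
  for `0 ≤ z < z_c`, and **Lemma 2.3: `V_M(z_c;A) ≤ 1`** (from `x^k ≤ K ∀k ⇒ x ≤ 1`, then continuity);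
* `bridgeGFpos_le_of_brGF_le`, `count_le_of_brGF_le` — if `V_M(z;A) ≤ ρ^A` for all `A ≥ 1` (`ρ < 1`)
  then `B⁺_M(z) ≤ ρ/(1-ρ)` and, by Hutchcroft's Prop. 2.1 = `sum_count_le_exp`,
  `c_N ≤ exp(2ρ/(1-ρ)) / z^{N+1}` (used by `SAWQuantitativeHW.lean`).
-/

noncomputable section

open Finset Filter Topology Literature.Probability.LatticeModels Literature.Probability.Percolation
open scoped BigOperators

namespace Literature.Probability.RandomPlanarGeometry.SAW.Zd

variable {d : ℕ} [NeZero d]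

/-! ### §A. Concatenation of bridges refines to spans: `a(z;A₁) a(z;A₂) ≤ a(z;A₁+A₂)` -/

/-- Membership in `brSpan`. [cite: MadrasSlade1993, Definition 3.1.3] -/
theorem mem_brSpan {n : ℕ} {A : ℤ} {ω : ℕ → Site d} :
    ω ∈ brSpan d n A ↔ ω ∈ bridges d n ∧ ω n 0 = A := by
  classical
  exact Finset.mem_filter

/-- First coordinates along a bridge from `0` lie in `[0, ωₙ(0)]`. [cite: MadrasSlade1993, Definition 1.2.4] -/
theorem apply_zero_mem_Icc_of_mem_bridges {n : ℕ} {ω : ℕ → Site d} (hω : ω ∈ bridges d n)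
    {i : ℕ} (hi : i ≤ n) : 0 ≤ ω i 0 ∧ ω i 0 ≤ ω n 0 := by
  obtain ⟨hωs, hb⟩ := mem_bridges.1 hω
  have h0 : ω 0 0 = 0 := by rw [(mem_saws.1 hωs).1]; rfl
  rcases Nat.eq_zero_or_pos i with rfl | hi0
  · refine ⟨h0.ge, ?_⟩
    rcases Nat.eq_zero_or_pos n with rfl | hn0
    · exact le_rfl
    · rw [h0]; exact (h0 ▸ (hb n hn0 le_rfl).1).le
  · have := hb i hi0 hi
    rw [h0] at this
    exact ⟨this.1.le, this.2⟩

/-- The concatenation of two bridges from `0` is a bridge whose endpoint level is the sum of the two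
endpoint levels ("If `ω₁ : 0 → L_n` and `ω₂ : 0 → L_m` are bridges, then we can form a bridge
`ω : 0 → L_{n+m}` by … concatenating the two paths").
[cite: Hutchcroft2018HammersleyWelsh, §2.1 (supermultiplicativity of `a(z;n)`); MadrasSlade1993, eq. (1.2.15)] -/
theorem concatWalk_mem_brSpan {m n : ℕ} {A B : ℤ} {ω υ : ℕ → Site d} (hω : ω ∈ brSpan d m A)
    (hυ : υ ∈ brSpan d n B) : concatWalk m ω υ ∈ brSpan d (m + n) (A + B) := by
  obtain ⟨hωb, hωA⟩ := mem_brSpan.1 hω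
  obtain ⟨hυb, hυB⟩ := mem_brSpan.1 hυ
  obtain ⟨hωs, hωbr⟩ := mem_bridges.1 hωb
  obtain ⟨hυs, hυbr⟩ := mem_bridges.1 hυb
  have hω0 := (mem_saws.1 hωs).1
  have hυ0 := (mem_saws.1 hυs).1
  have h00 : (0 : Site d) 0 = 0 := rfl
  have hle : ∀ i ≤ m, ω i 0 ≤ ω m 0 := fun i hi => (apply_zero_mem_Icc_of_mem_bridges hωb hi).2
  have hυn : 0 ≤ υ n 0 := (apply_zero_mem_Icc_of_mem_bridges hυb le_rfl).1
  have hgt : ∀ j, 1 ≤ j → j ≤ n → ω m 0 < (ω m + υ j) 0 := by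
    intro j h1 h2
    have := (hυbr j h1 h2).1
    rw [hυ0, h00] at this
    simp only [Pi.add_apply]
    linarith
  have hstart : concatWalk m ω υ 0 = 0 := by simp [concatWalk, hω0]
  have hlast : concatWalk m ω υ (m + n) 0 = ω m 0 + υ n 0 := by
    by_cases h : m + n ≤ m
    · have hn : n = 0 := by omega
      subst hn
      simp [concatWalk, hυ0]
    · simp [concatWalk, h]
  refine mem_brSpan.2 ⟨mem_bridges.2 ⟨concatWalk_mem_saws hωs hυs fun i hi j h1 h2 heq => ?_, ?_⟩, ?_⟩
  · have ha := hle i hi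
    have hb' := hgt j h1 h2
    rw [← heq] at hb'
    linarith
  · intro i h1 h2
    rw [hstart, hlast, h00]
    by_cases h : i ≤ m
    · simp only [concatWalk, if_pos h]
      have := (hωbr i h1 h).1
      rw [hω0, h00] at this
      exact ⟨this, (hle i h).trans (by linarith)⟩
    · simp only [concatWalk, if_neg h, Pi.add_apply]
      have := hυbr (i - m) (by omega) (by omega)
      rw [hυ0, h00] at this
      have hm0 : 0 ≤ ω m 0 := (apply_zero_mem_Icc_of_mem_bridges hωb le_rfl).1
      exact ⟨by linarith [this.1], by linarith [this.2]⟩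
  · rw [hlast, hωA, hυB]

/-- The cut time of a concatenation of bridges is determined: if `concatWalk m ω υ = concatWalk m' ω' υ'`
with `ω`, `ω'` bridges of the SAME span `A` (lengths `m`, `m'`) and `υ`, `υ'` bridges with
`m + n = m' + n'`, then `m = m'` (the cut is the last time at level `≤ A`). [folklore] -/
private theorem cut_eq_of_concat_eq {m n m' n' : ℕ} {A : ℤ} {ω υ ω' υ' : ℕ → Site d}
    (hω : ω ∈ brSpan d m A) (hυ : υ ∈ bridges d n) (hω' : ω' ∈ brSpan d m' A)
    (hsum : m + n = m' + n') (hle : m < m') (h : concatWalk m ω υ = concatWalk m' ω' υ') :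
    False := by
  obtain ⟨hωb, hωA⟩ := mem_brSpan.1 hω
  obtain ⟨hω'b, hω'A⟩ := mem_brSpan.1 hω'
  obtain ⟨hυs, hυbr⟩ := mem_bridges.1 hυ
  have hυ0 := (mem_saws.1 hυs).1
  have h00 : (0 : Site d) 0 = 0 := rfl
  -- position at time `m'` in both descriptions
  have h1 := congrFun h m'
  have hnot : ¬ m' ≤ m := Nat.not_le.2 hle
  simp only [concatWalk, if_neg hnot, if_pos le_rfl] at h1
  have h2 := congrArg (fun v : Site d => v 0) h1
  simp only [Pi.add_apply] at h2
  have h3 := (hυbr (m' - m) (by omega) (by omega)).1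
  rw [hυ0, h00] at h3
  rw [hωA, hω'A] at h2
  linarith

/-- **Span-refined supermultiplicativity of bridge counts**: for every total length `m`,
`Σ_{m₁+m₂ = m} #{bridges: length m₁, span A₁} · #{bridges: length m₂, span A₂} ≤ #{bridges: length m,
span A₁+A₂}` — concatenation is injective JOINTLY in the cut time and the two pieces.
[cite: Hutchcroft2018HammersleyWelsh, §2.1 ("the sequence `a(z;n)` is supermultiplicative")] -/
theorem sum_card_brSpan_mul_le (m : ℕ) (A₁ A₂ : ℤ) :
    ∑ m₁ ∈ Finset.range (m + 1), (brSpan d m₁ A₁).card * (brSpan d (m - m₁) A₂).card ≤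
      (brSpan d m (A₁ + A₂)).card := by
  classical
  have hcard : ((Finset.range (m + 1)).sigma fun m₁ => brSpan d m₁ A₁ ×ˢ brSpan d (m - m₁) A₂).card =
      ∑ m₁ ∈ Finset.range (m + 1), (brSpan d m₁ A₁).card * (brSpan d (m - m₁) A₂).card := by
    rw [Finset.card_sigma]; simp_rw [Finset.card_product]
  rw [← hcard]
  refine Finset.card_le_card_of_injOn (fun p => concatWalk p.1 p.2.1 p.2.2) ?_ ?_
  · rintro ⟨m₁, ω, υ⟩ hp
    simp only [Finset.mem_coe, Finset.mem_sigma, Finset.mem_range, Finset.mem_product] at hp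
    obtain ⟨hm₁, hω, hυ⟩ := hp
    rw [Finset.mem_coe]
    have := concatWalk_mem_brSpan hω hυ
    rwa [Nat.add_sub_cancel' (Nat.le_of_lt_succ hm₁)] at this
  · rintro ⟨m₁, ω, υ⟩ hp ⟨m₁', ω', υ'⟩ hp' h
    simp only [Finset.mem_coe, Finset.mem_sigma, Finset.mem_range, Finset.mem_product] at hp hp'
    obtain ⟨hm₁, hω, hυ⟩ := hp
    obtain ⟨hm₁', hω', hυ'⟩ := hp'
    dsimp only at h
    have hυb := (mem_brSpan.1 hυ).1
    have hυ'b := (mem_brSpan.1 hυ').1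
    -- the cut times agree
    have hmm : m₁ = m₁' := by
      rcases lt_trichotomy m₁ m₁' with hlt | heq | hgt
      · exact (cut_eq_of_concat_eq (n' := m - m₁') hω hυb hω' (by omega) hlt h).elim
      · exact heq
      · exact (cut_eq_of_concat_eq (n' := m - m₁) hω' hυ'b hω (by omega) hgt h.symm).elim
    subst hmm
    -- then the pieces agree (as in `bridgeCount_mul_le`)
    have hωs := mem_saws.1 (mem_bridges.1 (mem_brSpan.1 hω).1).1
    have hω's := mem_saws.1 (mem_bridges.1 (mem_brSpan.1 hω').1).1
    have hυs := mem_saws.1 (mem_bridges.1 hυb).1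
    have hυ's := mem_saws.1 (mem_bridges.1 hυ'b).1
    have h1 : ω = ω' := by
      funext i
      rcases le_or_gt i m₁ with hi | hi
      · have := congrFun h i
        simpa [concatWalk, hi] using this
      · rw [hωs.2.1 i hi.le, hω's.2.1 i hi.le]
        have := congrFun h m₁
        simpa [concatWalk] using this
    subst h1
    have h2 : υ = υ' := by
      funext j
      rcases Nat.eq_zero_or_pos j with rfl | hj
      · rw [hυs.1, hυ's.1]
      · have := congrFun h (m₁ + j)
        simpa [concatWalk, Nat.not_le.2 (by omega : m₁ < m₁ + j)] using this
    subst h2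
    rfl

/-- **Truncated supermultiplicativity of the span-`A` bridge generating functions**:
`V_{M₁}(z;A₁) · V_{M₂}(z;A₂) ≤ V_{M₁+M₂}(z;A₁+A₂)` for `z ≥ 0`, where `V_M(z;A) = brGF d M z A =
Σ_{m ≤ M} #{m-step bridges of span A} z^m` is the length-`M` truncation of Hutchcroft's `a(z;A)`.
[cite: Hutchcroft2018HammersleyWelsh, §2.1 ("`a(z;n+m) ≥ a(z;n) a(z;m)` for every `n, m ≥ 0`")] -/
theorem brGF_mul_le (M₁ M₂ : ℕ) {z : ℝ} (hz : 0 ≤ z) (A₁ A₂ : ℤ) :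
    brGF d M₁ z A₁ * brGF d M₂ z A₂ ≤ brGF d (M₁ + M₂) z (A₁ + A₂) := by
  classical
  rw [brGF, brGF, brGF, Finset.sum_mul_sum]
  -- regroup the double sum by total length
  have hmaps : ∀ p ∈ Finset.range (M₁ + 1) ×ˢ Finset.range (M₂ + 1),
      (fun p : ℕ × ℕ => p.1 + p.2) p ∈ Finset.range (M₁ + M₂ + 1) := by
    intro p hp
    rw [Finset.mem_product, Finset.mem_range, Finset.mem_range] at hp
    show p.1 + p.2 ∈ Finset.range (M₁ + M₂ + 1)
    rw [Finset.mem_range]; omega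
  rw [← Finset.sum_product', ← Finset.sum_fiberwise_of_maps_to hmaps]
  refine Finset.sum_le_sum fun n hn => ?_
  -- the fibre over total length `n`
  calc ∑ p ∈ Finset.range (M₁ + 1) ×ˢ Finset.range (M₂ + 1) with p.1 + p.2 = n,
        ((brSpan d p.1 A₁).card : ℝ) * z ^ p.1 * (((brSpan d p.2 A₂).card : ℝ) * z ^ p.2)
      = ∑ p ∈ Finset.range (M₁ + 1) ×ˢ Finset.range (M₂ + 1) with p.1 + p.2 = n,
        (((brSpan d p.1 A₁).card : ℝ) * (brSpan d (n - p.1) A₂).card) * z ^ n := by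
          refine Finset.sum_congr rfl fun p hp => ?_
          rw [Finset.mem_filter] at hp
          obtain ⟨-, hpn⟩ := hp
          rw [show n - p.1 = p.2 by omega, show z ^ n = z ^ p.1 * z ^ p.2 by rw [← pow_add, hpn]]
          ring
    _ ≤ ∑ m₁ ∈ Finset.range (n + 1),
        (((brSpan d m₁ A₁).card : ℝ) * (brSpan d (n - m₁) A₂).card) * z ^ n := by
          -- the fibre injects into `range (n+1)` by `p ↦ p.1`
          rw [← Finset.sum_image (f := fun m₁ => (((brSpan d m₁ A₁).card : ℝ) *
              (brSpan d (n - m₁) A₂).card) * z ^ n) (s := (Finset.range (M₁ + 1) ×ˢ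
              Finset.range (M₂ + 1)).filter fun p => p.1 + p.2 = n) (g := fun p => p.1) ?_]
          · refine Finset.sum_le_sum_of_subset_of_nonneg ?_ fun _ _ _ => by positivity
            intro m₁ hm₁
            rw [Finset.mem_image] at hm₁
            obtain ⟨p, hp, rfl⟩ := hm₁
            rw [Finset.mem_filter] at hp
            rw [Finset.mem_range]; omega
          · intro p hp q hq hpq
            rw [Finset.mem_coe, Finset.mem_filter] at hp hq
            exact Prod.ext hpq (by simp only at hpq; omega)
    _ = (∑ m₁ ∈ Finset.range (n + 1),
          ((brSpan d m₁ A₁).card * (brSpan d (n - m₁) A₂).card : ℕ) : ℝ) * z ^ n := by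
          rw [Finset.sum_mul]; push_cast; rfl
    _ ≤ ((brSpan d n (A₁ + A₂)).card : ℝ) * z ^ n := by
          gcongr
          exact_mod_cast sum_card_brSpan_mul_le n A₁ A₂

/-- Iterated: `V_M(z;A)^k ≤ V_{kM}(z;kA)`. [cite: Hutchcroft2018HammersleyWelsh, §2.1] -/
theorem brGF_pow_le (M : ℕ) {z : ℝ} (hz : 0 ≤ z) (A : ℤ) (k : ℕ) :
    brGF d M z A ^ k ≤ brGF d (k * M) z (k * A) := by
  induction k with
  | zero =>
    -- `V_0(z;0) ≥ #brSpan 0 0 · z^0 = 1`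
    classical
    simp only [pow_zero, Nat.cast_zero, zero_mul]
    rw [brGF, Finset.sum_range_one, pow_zero, mul_one]
    have : (1 : ℕ) ≤ (brSpan d 0 0).card := by
      refine Finset.card_pos.2 ⟨straightWalk d 0, mem_brSpan.2 ⟨mem_bridges.2 ⟨straightWalk_mem_saws d 0,
        fun i h1 h2 => by omega⟩, by simp [straightWalk]⟩⟩
    exact_mod_cast this
  | succ k ih =>
    have h0 : 0 ≤ brGF d M z A := Finset.sum_nonneg fun n _ => by positivity
    calc brGF d M z A ^ (k + 1) = brGF d M z A ^ k * brGF d M z A := pow_succ _ _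
      _ ≤ brGF d (k * M) z (k * A) * brGF d M z A := mul_le_mul_of_nonneg_right ih h0
      _ ≤ brGF d (k * M + M) z (k * A + A) := brGF_mul_le _ _ hz _ _
      _ = brGF d ((k + 1) * M) z ((k + 1 : ℕ) * A) := by
          congr 1
          · ring
          · push_cast; ring

/-! ### §B. A priori bounds below `z_c` and Lemma 2.3: `a(z_c; A) ≤ 1` -/

/-- `V_M(z;A) ≤ Σ_{m ≤ M} b_m z^m ≤ Σ_{m ≤ M} (zμ)^m ≤ (1 - zμ)⁻¹` for `0 ≤ z < z_c` (`b_m ≤ μ^m`,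
`bridgeCount_le_pow`): below `z_c` everything is dominated by a geometric series.
[cite: Hutchcroft2018HammersleyWelsh, §2.1, proof of Lemma 2.3 ("If `z < z_c` then `B(z) < ∞`")] -/
theorem brGF_le_geom (M : ℕ) {z : ℝ} (hz : 0 ≤ z) (hz1 : z * connectiveConstant d < 1) (A : ℤ) :
    brGF d M z A ≤ (1 - z * connectiveConstant d)⁻¹ := by
  classical
  have hμ := connectiveConstant_pos d
  have hr0 : 0 ≤ z * connectiveConstant d := mul_nonneg hz hμ.le
  calc brGF d M z A ≤ ∑ m ∈ Finset.range (M + 1), (bridgeCount d m : ℝ) * z ^ m := by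
        refine Finset.sum_le_sum fun m _ => ?_
        refine mul_le_mul_of_nonneg_right ?_ (pow_nonneg hz m)
        exact_mod_cast Finset.card_le_card (Finset.filter_subset _ (bridges d m))
    _ ≤ ∑ m ∈ Finset.range (M + 1), (z * connectiveConstant d) ^ m := by
        refine Finset.sum_le_sum fun m _ => ?_
        rw [mul_pow, mul_comm]
        exact mul_le_mul_of_nonneg_left (bridgeCount_le_pow m) (pow_nonneg hz m)
    _ ≤ ∑' m : ℕ, (z * connectiveConstant d) ^ m :=
        (summable_geometric_of_lt_one hr0 hz1).sum_le_tsum _ fun m _ => pow_nonneg hr0 m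
    _ = (1 - z * connectiveConstant d)⁻¹ := tsum_geometric_of_lt_one hr0 hz1

/-- If the powers `x^k`, `k ≥ 1`, of a real `x` are bounded, then `x ≤ 1`. [folklore] -/
private theorem le_one_of_pow_le {x K : ℝ} (h : ∀ k : ℕ, 1 ≤ k → x ^ k ≤ K) : x ≤ 1 := by
  by_contra hx1
  push Not at hx1
  have ht := tendsto_pow_atTop_atTop_of_one_lt hx1
  obtain ⟨k, hk⟩ := (ht.eventually (eventually_gt_atTop K)).exists_forall_of_atTop
  have := hk (max k 1) (le_max_left _ _)
  linarith [h (max k 1) (le_max_right _ _)]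

/-- **Lemma 2.3 below `z_c` (finite form)**: `V_M(z;A) ≤ 1` for `0 ≤ z < z_c`, all `M`, `A` — from
`V_M(z;A)^k ≤ V_{kM}(z;kA) ≤ (1 - zμ)⁻¹` (supermultiplicativity in the span and the geometric bound).
[cite: Hutchcroft2018HammersleyWelsh, Lemma 2.3] -/
theorem brGF_le_one_of_lt (M : ℕ) {z : ℝ} (hz : 0 ≤ z) (hz1 : z * connectiveConstant d < 1) (A : ℤ) :
    brGF d M z A ≤ 1 := by
  refine le_one_of_pow_le (K := (1 - z * connectiveConstant d)⁻¹) fun k _ => ?_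
  exact (brGF_pow_le M hz A k).trans (brGF_le_geom _ hz hz1 _)

/-- **Lemma 2.3 at `z_c` (finite form): `V_M(z_c;A) ≤ 1`**, i.e. every truncation of
`a(z_c;A) = Σ_m #{m-step bridges of span A} μ^{-m}` is at most `1` ("Since this bound holds for all
`z < z_c`, it also holds for `z = z_c` by left continuity").
[cite: Hutchcroft2018HammersleyWelsh, Lemma 2.3 ("`ξ(z_c) ≥ 0`")] -/
theorem brGF_critical_le_one (M : ℕ) (A : ℤ) : brGF d M (connectiveConstant d)⁻¹ A ≤ 1 := by
  have hμ := connectiveConstant_pos d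
  set zc : ℝ := (connectiveConstant d)⁻¹ with hzc
  have hzc0 : 0 < zc := inv_pos.2 hμ
  have hcont : Continuous fun z : ℝ => brGF d M z A :=
    continuous_finsetSum _ fun n _ => continuous_const.mul (continuous_pow n)
  have htend : Tendsto (fun z : ℝ => brGF d M z A) (𝓝[<] zc) (𝓝 (brGF d M zc A)) :=
    (hcont.tendsto zc).mono_left nhdsWithin_le_nhds
  have hev : ∀ᶠ z in 𝓝[<] zc, brGF d M z A ≤ 1 := by
    have h1 : ∀ᶠ z in 𝓝[<] zc, 0 < z := (eventually_gt_nhds hzc0).filter_mono nhdsWithin_le_nhds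
    have h2 : ∀ᶠ z in 𝓝[<] zc, z < zc := eventually_mem_nhdsWithin
    filter_upwards [h1, h2] with z hz0 hzlt
    refine brGF_le_one_of_lt M hz0.le ?_ A
    calc z * connectiveConstant d < zc * connectiveConstant d := mul_lt_mul_of_pos_right hzlt hμ
      _ = 1 := inv_mul_cancel₀ hμ.ne'
  exact le_of_tendsto htend hev

/-! ### §C. From a span rate `a(z;A) ≤ ρ^A` to `B(z)` and `c_N` -/

/-- **`B⁺(z) ≤ ρ/(1-ρ)`**: if every span-`A` bridge generating function satisfies `V_M(z;A) ≤ ρ^A`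
(`A ≥ 1`, `0 ≤ ρ < 1`), then `Σ_{1 ≤ m ≤ M} b_m z^m ≤ Σ_{A=1}^{M} ρ^A ≤ ρ/(1-ρ)` (a bridge of length
`m ∈ [1, M]` has span in `[1, M]`) — "`B((1-ε)z_c) = Σ_n a((1-ε)z_c;n) ≤ Σ_n e^{ψ(ε)log(1-ε)n}`".
[cite: Hutchcroft2018HammersleyWelsh, proof of Theorem 1.4 (first display)] -/
theorem bridgeGFpos_le_of_brGF_le (M : ℕ) {z ρ : ℝ} (hz : 0 ≤ z) (hρ0 : 0 ≤ ρ) (hρ1 : ρ < 1)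
    (h : ∀ A : ℕ, 1 ≤ A → brGF d M z A ≤ ρ ^ A) : bridgeGFpos d M z ≤ ρ / (1 - ρ) := by
  classical
  -- every bridge of length `1 ≤ n ≤ M` has span in `[1, M]`
  have hcover : ∀ n, 1 ≤ n → n ≤ M →
      (bridgeCount d n : ℝ) ≤ ∑ a ∈ Finset.range M, ((brSpan d n ((a + 1 : ℕ) : ℤ)).card : ℝ) := by
    intro n hn1 hnM
    have hsub : bridges d n ⊆ (Finset.range M).biUnion fun a => brSpan d n ((a + 1 : ℕ) : ℤ) := by
      intro ω hω
      rw [Finset.mem_biUnion]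
      obtain ⟨hωs, hbr⟩ := mem_bridges.1 hω
      obtain ⟨h00, -, hadj, -⟩ := mem_saws.1 hωs
      have hlow : 0 < ω n 0 := by
        have := (hbr n hn1 le_rfl).1
        rwa [h00] at this
      have hup : ω n 0 ≤ n := (le_abs_self _).trans (abs_apply_le_of_adj h00 hadj n le_rfl 0)
      refine ⟨(ω n 0).toNat - 1, ?_, mem_brSpan.2 ⟨hω, ?_⟩⟩
      · rw [Finset.mem_range]; omega
      · push_cast; omega
    calc (bridgeCount d n : ℝ) = ((bridges d n).card : ℝ) := rfl
      _ ≤ (((Finset.range M).biUnion fun a => brSpan d n ((a + 1 : ℕ) : ℤ)).card : ℝ) := by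
          exact_mod_cast Finset.card_le_card hsub
      _ ≤ ∑ a ∈ Finset.range M, ((brSpan d n ((a + 1 : ℕ) : ℤ)).card : ℝ) := by
          exact_mod_cast Finset.card_biUnion_le
  have hgeom : ∑ a ∈ Finset.range M, ρ ^ a ≤ (1 - ρ)⁻¹ :=
    ((summable_geometric_of_lt_one hρ0 hρ1).sum_le_tsum _ fun a _ => pow_nonneg hρ0 a).trans
      (tsum_geometric_of_lt_one hρ0 hρ1).le
  calc bridgeGFpos d M z
      ≤ ∑ n ∈ Finset.range (M + 1), ∑ a ∈ Finset.range M,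
          ((brSpan d n ((a + 1 : ℕ) : ℤ)).card : ℝ) * z ^ n := by
        refine Finset.sum_le_sum fun n hn => ?_
        rw [Finset.mem_range] at hn
        split_ifs with hn0
        · exact Finset.sum_nonneg fun a _ => by positivity
        · rw [← Finset.sum_mul]
          exact mul_le_mul_of_nonneg_right (hcover n (by omega) (by omega)) (pow_nonneg hz n)
    _ = ∑ a ∈ Finset.range M, brGF d M z ((a + 1 : ℕ) : ℤ) := by
        rw [Finset.sum_comm]
        rfl
    _ ≤ ∑ a ∈ Finset.range M, ρ ^ (a + 1) := Finset.sum_le_sum fun a _ => h (a + 1) (by omega)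
    _ = ρ * ∑ a ∈ Finset.range M, ρ ^ a := by
        rw [Finset.mul_sum]
        refine Finset.sum_congr rfl fun a _ => ?_
        rw [pow_succ, mul_comm]
    _ ≤ ρ * (1 - ρ)⁻¹ := mul_le_mul_of_nonneg_left hgeom hρ0
    _ = ρ / (1 - ρ) := (div_eq_mul_inv _ _).symm

/-- **`c_N z^{N+1} ≤ χ-bound`**: if `V_M(z;A) ≤ ρ^A` for all `M` and `A ≥ 1` (`0 < z`, `0 ≤ ρ < 1`), then
`c_N ≤ exp(2ρ/(1-ρ)) / z^{N+1}` — Proposition 2.1 (Madras–Slade (3.1.13), tree `sum_count_le_exp`)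
and the "trivial inequality" (2.6) `z^N c_N ≤ χ(z)`.
[cite: Hutchcroft2018HammersleyWelsh, Proposition 2.1 and eq. (2.6)] -/
theorem count_le_of_brGF_le {z ρ : ℝ} (hz : 0 < z) (hρ0 : 0 ≤ ρ) (hρ1 : ρ < 1)
    (h : ∀ M : ℕ, ∀ A : ℕ, 1 ≤ A → brGF d M z A ≤ ρ ^ A) (N : ℕ) :
    (count d N : ℝ) ≤ Real.exp (2 * (ρ / (1 - ρ))) / z ^ (N + 1) := by
  have h1 := sum_count_le_exp (d := d) N hz.le
  have h2 : bridgeGFpos d (N + 1) z ≤ ρ / (1 - ρ) :=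
    bridgeGFpos_le_of_brGF_le (N + 1) hz.le hρ0 hρ1 (h (N + 1))
  have h3 : (count d N : ℝ) * z ^ (N + 1) ≤
      ∑ n ∈ Finset.range (N + 1), (count d n : ℝ) * z ^ (n + 1) :=
    Finset.single_le_sum (f := fun n => (count d n : ℝ) * z ^ (n + 1))
      (fun n _ => by positivity) (Finset.mem_range.2 (Nat.lt_succ_self N))
  rw [le_div_iff₀ (pow_pos hz _)]
  exact h3.trans (h1.trans (Real.exp_le_exp.2 (by linarith)))


end Literature.Probability.RandomPlanarGeometry.SAW.Zd

end
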